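import Mathlib
import Summits.BirchSwinnertonDyer.BirchSwinnertonDyer.Theorems.ManinLocalTwoThreeThreeDvdModularDegree
import Summits.BirchSwinnertonDyer.BirchSwinnertonDyer.Theorems.ManinLocalTwoThreeCuspThreeTorsionAtFour
import HarnessLib

/-!
# `4 ∥ N`: either `3 ∣ deg φ_D` or the cusp `1/M` maps to a point of EXACT order `3` (E-an-45′ + E-an-46 dichotomy)

Summit `BirchSwinnertonDyer`, sub-problem `BirchSwinnertonDyer`, route `ManinLocalTwoThree`; width seat `bsd-line-manin23-p2`
(gen 9), `--supports` the crux C2 `ManinOddAtFour` (stmt-BirchSwinnertonDyer-22967).  Cell `bsd-f2-manin`, an lens (`4 ∥ N` package,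
E-an-45′ `cuspImageThreeTorsion_holds`: `3·φ_D([1/M]) = O`; E-an-46 `threeDvdModularDegreeOfCuspImageZero_holds`: `φ_D([1/M]) = O ⟹
3 ∣ deg φ_D`): the `3`-adic twin of the seat's `two_dvd_modularDegree_or_addOrderOf_eq_two` — for every datum at level `4M`, `M` odd,
`3 ∣ deg φ_D` or `φ_D([1/M])` has exact order `3` in `E(ℂ)`; equivalently `3 ∤ deg φ_D ⟹ ord φ_D([1/M]) = 3` (the `ℂ`-points
form of E-an-46′, whose rational-point form needs the cusp-rationality vocabulary).

PROVED here (no `sorry`): **`three_dvd_modularDegree_or_addOrderOf_cuspImage_eq_three`**, `addOrderOf_cuspImage_eq_three_of_not_three_dvd`.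
BSD is not proved by this; Manin's conjecture is not proved by this.
-/

set_option autoImplicit false
set_option linter.dupNamespace false

noncomputable section

open scoped MatrixGroups ModularForm
open CongruenceSubgroup
open Literature.NumberTheory.EllipticCurves Literature.NumberTheory.EllipticCurves.ModularForms
open Summit.BirchSwinnertonDyer.Rank1Residual.ManinAdditive

namespace Summit.BirchSwinnertonDyer.BirchSwinnertonDyer.Theorems.ManinLocalTwoThree

/-- **`3 ∣ deg φ_D` or `φ_D([1/M])` has exact order `3`** (level `4M`, `M` odd, any datum of any curve). -/
theorem three_dvd_modularDegree_or_addOrderOf_cuspImage_eq_three {M : ℕ} [NeZero (4 * M)] (hM : Odd M)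
    {W : WeierstrassCurve ℚ} [W.IsElliptic] (D : ModularParametrizationData W (4 * M)) :
    3 ∣ D.modularDegree ∨ addOrderOf (D.uniformize ((D.c : ℂ) * modularSymbol D.f (1 / (M : ℚ)))) = 3 := by
  by_cases h0 : D.uniformize ((D.c : ℂ) * modularSymbol D.f (1 / (M : ℚ))) = 0
  · exact Or.inl (threeDvdModularDegreeOfCuspImageZero_holds W hM D h0)
  · haveI : Fact (Nat.Prime 3) := ⟨Nat.prime_three⟩
    exact Or.inr (addOrderOf_eq_prime (cuspImageThreeTorsion_holds W hM D) h0)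

/-- **`3 ∤ deg φ_D ⟹ ord φ_D([1/M]) = 3`** (the `ℂ`-points form of E-an-46′). -/
theorem addOrderOf_cuspImage_eq_three_of_not_three_dvd {M : ℕ} [NeZero (4 * M)] (hM : Odd M)
    {W : WeierstrassCurve ℚ} [W.IsElliptic] (D : ModularParametrizationData W (4 * M)) (h3 : ¬ 3 ∣ D.modularDegree) :
    addOrderOf (D.uniformize ((D.c : ℂ) * modularSymbol D.f (1 / (M : ℚ)))) = 3 :=
  (three_dvd_modularDegree_or_addOrderOf_cuspImage_eq_three hM D).resolve_left h3

end Summit.BirchSwinnertonDyer.BirchSwinnertonDyer.Theorems.ManinLocalTwoThree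

end
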